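import Summits.AtomisticToContinuum.FouriersLaw.Theorems.EmbeddedDrudeMourreAbelThermodynamicLimitOfLowerBound
import HarnessLib

/-!
# Split glue of the crux `EmbeddedDrudeMourre.AbelThermodynamicLimit` (item stmt-AtomisticToContinuum-17942)

The item-level split (gen 1) of the crux `AbelThermodynamicLimit` (stmt-AtomisticToContinuum-12596) on route
EmbeddedDrudeMourre has the two children `UniformAbelianRegularity` (≡ stmt-AtomisticToContinuum-13416) and
`ConductanceLowerBound` (≡ stmt-AtomisticToContinuum-11749) and the glue item
`AbelThermodynamicLimitOfSubs : UniformAbelianRegularity → ConductanceLowerBound → AbelThermodynamicLimit`.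
The glue is LITERALLY the landed certificate of line `loomis-compact-horizon-witness` (rev 5, p127832)
`LoomisCompactHorizonWitness.stub_cruxOfRegularityOfLowerBound :
  StaticAbelianSqueeze.UniformAbelianRegularity → StaticAbelianSqueeze.ConductanceLowerBound →
  EmbeddedDrudeMourre.AbelThermodynamicLimit`,
because the EmbeddedDrudeMourre children are definitionally the StaticAbelianSqueeze decls (same bodies).
It could not be rendered `--glue-by` inside the route file (that certificate's module imports the route file),
so it is closed here, in a Theorems module, by the one-line term.

References: Bonetto–Lebowitz–Rey-Bellet 2000 §7 eq. (37); Kundu–Dhar–Narayan 2009 eqs. (8)–(15).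
No definitions, no named facts, no hypotheses beyond the two children.
-/

namespace Summit.AtomisticToContinuum.FouriersLaw.Theorems.EmbeddedDrudeMourre

/-- **Split glue (item stmt-AtomisticToContinuum-17942).**  The two children of the gen-1 split of the crux
`EmbeddedDrudeMourre.AbelThermodynamicLimit` — `UniformAbelianRegularity` (N-uniform Abelian regularity of the open
chain's equilibrium total-current autocorrelation, stmt-13416) and `ConductanceLowerBound` (`liminf_N D_N > 0` along
every steady family, stmt-11749) — imply the crux, by the landed certificate
`LoomisCompactHorizonWitness.stub_cruxOfRegularityOfLowerBound` (output witness = the regular pair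
`(μ*, D*)` with `κ = L/T²`, `L` the common limit of `T²·D_N`; positivity of `L` from the lower bound along the
canonical CEHR steady family).  The children unfold definitionally to the `StaticAbelianSqueeze` decls. -/
theorem abelThermodynamicLimitOfSubs_proof :
    Summit.AtomisticToContinuum.FouriersLaw.Theses.EmbeddedDrudeMourre.AbelThermodynamicLimitOfSubs := by
  unfold Summit.AtomisticToContinuum.FouriersLaw.Theses.EmbeddedDrudeMourre.AbelThermodynamicLimitOfSubs
  intro hR hC
  exact Summit.AtomisticToContinuum.FouriersLaw.Theorems.AbelThermodynamicLimit.LoomisCompactHorizonWitness.stub_cruxOfRegularityOfLowerBound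
    hR hC

end Summit.AtomisticToContinuum.FouriersLaw.Theorems.EmbeddedDrudeMourre
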